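import Mathlib.NumberTheory.Padics.Complex
import Mathlib.Topology.LocallyConstant.Basic
import Mathlib.Topology.Instances.Matrix
import Literature.NumberTheory.GaloisRepresentations.ResidualPairIntegrality
import Literature.NumberTheory.GaloisRepresentations.FrobeniusDensity
import Literature.NumberTheory.Automorphic.ChebotarevArtinRepHolds
import Literature.NumberTheory.GaloisRepresentations.ResidualRepresentation
import Literature.NumberTheory.GaloisRepresentations.CompactImageCharpolyIntegral
import HarnessLib

/-!
# Residual characteristic polynomials of an integral model (Chebotarev step)

Stub `stub_residualCharpoly` of line `endoscopic-crossing-euler` for the crux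
`Summit.Langlands.Langlands.Theses.PhantomRMYoshida.ResiduallyYoshidaLifting` (stmt-Langlands-13639).

Let `p` be a prime, `k` a field of characteristic `p` with the discrete topology,
`red : ℤ̄_p = 𝒪[ℚ̄_p] → k` a ring map, `σ, σ' : Γ_ℚ → GL₂(k)` and `r : Γ_ℚ → GL₄(ℚ̄_p)` continuous,
and `rint : Γ_ℚ → GL₄(ℤ̄_p)` an integral model of `r` (`rint = P⁻¹ r P`).  Suppose that at almost
all finite places `v` the three representations are unramified and the integral Frobenius
polynomial of `r` at `v` reduces through `red` to `charpoly σ(Frob_v) · charpoly σ'(Frob_v)`.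
Then for EVERY `g ∈ Γ_ℚ`, `red (det(X - rint g)) = det(X - σ g) · det(X - σ' g)`.

Proof: `red` kills the maximal ideal `{‖x‖ < 1}` of `ℤ̄_p` (`char k = p`), so
`g ↦ red (rint g)` is locally constant on `Γ_ℚ`, as are `σ`, `σ'` (discrete `k`); hence the set of
`g` at which the identity holds is closed.  It contains every arithmetic Frobenius at a place
outside the finite exceptional set (uniqueness of Frobenius polynomials,
`FramedGaloisRep.HasFrobCharpolyAt.unique(_map)`, `IsUnramifiedAt.hasFrobCharpolyAt_charpoly`,
conjugation invariance of `charpoly`), and these Frobenii are dense in `Γ_ℚ`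
(`absoluteGaloisGroup.frobenius_dense`, from the discharged Chebotarev theorem
`Automorphic.chebotarev_artinRep_holds`).

## References

* J.-P. Serre, *Abelian ℓ-adic representations and elliptic curves* (1968), Ch. I §2.2 Cor. 2 (a)
  (Frobenii are dense), §2.3. [SerreAbelianLadic1968]
* P. Deligne, J.-P. Serre, Formes modulaires de poids 1, Ann. Sci. ÉNS 7 (1974), §6.
  [DeligneSerreASENS1974]
-/

noncomputable section

-- `Summit.Langlands.Langlands.…` (summit = sub-problem name, D-0017 layout) trips `dupNamespace` on every decl.
set_option linter.dupNamespace false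

open Field IsDedekindDomain Filter Topology
open scoped NumberField

namespace Summit.Langlands.Langlands.Cruxes.ResiduallyYoshidaLifting.EndoscopicCrossingEuler

open Literature.NumberTheory.GaloisRepresentations

section Helpers

variable {p : ℕ} [Fact p.Prime] {k : Type} [Field k] [CharP k p]

/-- Every ring map `red : 𝒪[ℚ̄_p] → k` to a field of characteristic `p` kills the maximal ideal
`{‖x‖ < 1}`: `‖x‖^N ≤ ‖p‖` for some `N`, so `x^N ∈ p𝒪` and `red(x)^N = 0`. [folklore] -/
private theorem red_eq_zero_of_norm_lt_one (red : Valued.integer (PadicAlgCl p) →+* k)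
    (x : Valued.integer (PadicAlgCl p)) (hx : ‖(x : PadicAlgCl p)‖ < 1) : red x = 0 := by
  -- adapted from `Cruxes/ResiduallyYoshidaLifting/Disproof.lean`, `red_eq_zero_of_norm_lt_one`
  have hp0 : 0 < ‖((p : ℕ) : PadicAlgCl p)‖ :=
    norm_pos_iff.2 (Nat.cast_ne_zero.2 (Fact.out : p.Prime).ne_zero)
  obtain ⟨N, hN⟩ := exists_pow_lt_of_lt_one hp0 hx
  have hz : ‖(x : PadicAlgCl p) ^ N / (p : PadicAlgCl p)‖ ≤ 1 := by
    rw [norm_div, norm_pow]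
    exact (div_le_one hp0).2 hN.le
  let z : Valued.integer (PadicAlgCl p) := ⟨_, PadicAlgCl.mem_integer_of_norm_le_one hz⟩
  have hxN : x ^ N = (p : Valued.integer (PadicAlgCl p)) * z := by
    apply Subtype.ext
    change ((x ^ N : Valued.integer (PadicAlgCl p)) : PadicAlgCl p) =
      ((p : Valued.integer (PadicAlgCl p)) : PadicAlgCl p) *
        ((x : PadicAlgCl p) ^ N / (p : PadicAlgCl p))
    have hp0' : (p : PadicAlgCl p) ≠ 0 := norm_pos_iff.1 hp0
    push_cast
    field_simp
  have h0 : red x ^ N = 0 := by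
    rw [← map_pow, hxN, map_mul, map_natCast, CharP.cast_eq_zero, zero_mul]
  exact eq_zero_of_pow_eq_zero h0

/-- Two integers of `ℚ̄_p` congruent modulo the maximal ideal have the same image under any ring
map `red : 𝒪[ℚ̄_p] → k` to a field of characteristic `p`. [folklore] -/
private theorem red_eq_of_norm_sub_lt_one (red : Valued.integer (PadicAlgCl p) →+* k)
    {x y : Valued.integer (PadicAlgCl p)} (h : ‖(x : PadicAlgCl p) - y‖ < 1) : red x = red y := by
  have := red_eq_zero_of_norm_lt_one red (x - y) (by simpa using h)
  rwa [map_sub, sub_eq_zero] at this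

end Helpers

/-- The characteristic polynomial of an integral matrix `A` with `A = P⁻¹ B P` over the field maps
to that of `B` (`Matrix.charpoly_map`, `Matrix.charpoly_units_conj'`). [folklore] -/
private theorem charpoly_map_subtype_of_map_eq {F : Type*} [Field F] {O : Subring F} {n : Type*}
    [Fintype n] [DecidableEq n] {A : GL n O} {B P : GL n F}
    (h : Matrix.GeneralLinearGroup.map O.subtype A = P⁻¹ * B * P) :
    (A.val.charpoly).map O.subtype = B.val.charpoly := by
  -- adapted from `Literature.NumberTheory.GaloisRepresentations.charpoly_integralModel`
  rw [← Matrix.charpoly_map]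
  have h1 : A.val.map O.subtype =
      ((Matrix.GeneralLinearGroup.map O.subtype A : GL n F) : Matrix n n F) := rfl
  rw [h1, h, Units.val_mul, Units.val_mul, Matrix.coe_units_inv]
  exact Matrix.charpoly_units_conj' P _

/-- An eventually-cofinite property holds outside a finite set. [folklore] -/
private theorem exists_finite_forall_of_eventually_cofinite {α : Type*} {q : α → Prop}
    (h : ∀ᶠ x in cofinite, q x) : ∃ S : Set α, S.Finite ∧ ∀ x ∉ S, q x :=
  ⟨{x | ¬q x}, Filter.eventually_cofinite.1 h, fun _ hx => not_not.1 hx⟩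

/-- Two locally constant functions which agree on a dense set agree everywhere (the coincidence
set is closed). [folklore] -/
private theorem forall_eq_of_dense {X Y : Type*} [TopologicalSpace X] {D : Set X} (hD : Dense D)
    {f g : X → Y} (hf : IsLocallyConstant f) (hg : IsLocallyConstant g)
    (h : ∀ x ∈ D, f x = g x) (x : X) : f x = g x := by
  have hE : IsClosed {x | f x = g x} := by
    have h1 : IsLocallyConstant fun x => (f x = g x : Prop) :=
      (hf.prodMk hg).comp fun t : Y × Y => (t.1 = t.2 : Prop)
    convert h1.isClosed_fiber True using 1
    ext y
    simp
  exact hE.closure_subset_iff.2 h (hD x)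

/-- **Stub 2a (residual characteristic polynomials of an integral model; Chebotarev).**  Let
`r : Γ_ℚ → GL₄(ℚ̄_p)` be continuous, `rint : Γ_ℚ → GL₄(ℤ̄_p)` a homomorphism with `rint = P⁻¹ r P`, and suppose the
crux's residual clause: at almost all `v`, `r, σ, σ'` are unramified and the integral Frobenius polynomial of `r`
reduces through `red : ℤ̄_p → k` to `charpoly σ(Frob_v) · charpoly σ'(Frob_v)`.  Then for EVERY `g ∈ Γ_ℚ`,
`red (det(X - rint g)) = det(X - σ g) · det(X - σ' g)`.  Proof: `red` kills the maximal ideal of `ℤ̄_p`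
(`char k = p`), so `g ↦ red(rint g)` is locally constant, as are `σ, σ'` (discrete `k`); the identity holds at every
arithmetic Frobenius outside a finite set (uniqueness of Frobenius polynomials, `HasFrobCharpolyAt.unique(_map)`,
`IsUnramifiedAt.hasFrobCharpolyAt_charpoly`, conjugation invariance of `charpoly`), and these are dense
(`absoluteGaloisGroup.frobenius_dense chebotarev_artinRep_holds`).
[cite: SerreAbelianLadic1968, Ch. I §2.2 Cor. 2 (a) and §2.3] -/
theorem stub_residualCharpoly :
    ∀ (p : ℕ) [Fact p.Prime] (k : Type) [Field k] [CharP k p] [TopologicalSpace k] [DiscreteTopology k]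
      (red : Valued.integer (PadicAlgCl p) →+* k)
      (σ σ' : Literature.NumberTheory.GaloisRepresentations.FramedGaloisRep ℚ k 2)
      (r : Literature.NumberTheory.GaloisRepresentations.FramedGaloisRep ℚ (PadicAlgCl p) 4)
      (P : GL (Fin 4) (PadicAlgCl p))
      (rint : Field.absoluteGaloisGroup ℚ →* GL (Fin 4) (Valued.integer (PadicAlgCl p))),
      (∀ g, Matrix.GeneralLinearGroup.map (Valued.integer (PadicAlgCl p)).subtype (rint g) = P⁻¹ * r g * P) →
      (∀ᶠ v : IsDedekindDomain.HeightOneSpectrum (NumberField.RingOfIntegers ℚ) in Filter.cofinite,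
        r.IsUnramifiedAt v ∧ σ.IsUnramifiedAt v ∧ σ'.IsUnramifiedAt v ∧
        ∃ (P : Polynomial (Valued.integer (PadicAlgCl p))) (P₁ P₂ : Polynomial k),
          r.HasFrobCharpolyAt v (P.map (Valued.integer (PadicAlgCl p)).subtype) ∧
          σ.HasFrobCharpolyAt v P₁ ∧ σ'.HasFrobCharpolyAt v P₂ ∧ P.map red = P₁ * P₂) →
      ∀ g, ((rint g).val.charpoly).map red = (σ g).val.charpoly * (σ' g).val.charpoly := by
  intro p _ k _ _ _ _ red σ σ' r P rint hrint hae
  -- the finite exceptional set `S` and the density of the Frobenii outside `S` (Chebotarev)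
  obtain ⟨S, hS, hSc⟩ := exists_finite_forall_of_eventually_cofinite hae
  have hD := absoluteGaloisGroup.frobenius_dense
    Literature.NumberTheory.Automorphic.chebotarev_artinRep_holds ℚ S hS
  -- `g ↦ red (rint g)` is locally constant: `red` kills `{‖x‖ < 1}` and the entries of
  -- `rint g = P⁻¹ r(g) P` are continuous in `g`
  have hloc : IsLocallyConstant fun g : absoluteGaloisGroup ℚ => (rint g).val.map red := by
    refine (IsLocallyConstant.iff_eventually_eq _).2 fun g₀ => ?_
    have hent : ∀ i j : Fin 4, ∀ᶠ g in 𝓝 g₀, red ((rint g).val i j) = red ((rint g₀).val i j) := by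
      intro i j
      have hc : Continuous fun g : absoluteGaloisGroup ℚ =>
          ((P⁻¹ * r g * P : GL (Fin 4) (PadicAlgCl p)) : Matrix (Fin 4) (Fin 4) (PadicAlgCl p)) i j :=
        (Units.continuous_val.comp
          ((continuous_const.mul (map_continuous r)).mul continuous_const)).matrix_elem i j
      have he : ∀ g, ((P⁻¹ * r g * P : GL (Fin 4) (PadicAlgCl p)) :
          Matrix (Fin 4) (Fin 4) (PadicAlgCl p)) i j = (((rint g).val i j : _) : PadicAlgCl p) := by
        intro g
        rw [← hrint g]
        rfl
      refine (Metric.tendsto_nhds.1 (hc.tendsto g₀) 1 one_pos).mono fun g hg => ?_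
      rw [dist_eq_norm, he, he] at hg
      exact red_eq_of_norm_sub_lt_one red hg
    have hall : ∀ᶠ g in 𝓝 g₀, ∀ i j : Fin 4, red ((rint g).val i j) = red ((rint g₀).val i j) :=
      eventually_all.2 fun i => eventually_all.2 fun j => hent i j
    exact hall.mono fun g hg => Matrix.ext fun i j => hg i j
  have hlhs : IsLocallyConstant fun g : absoluteGaloisGroup ℚ => ((rint g).val.charpoly).map red := by
    have h1 := hloc.comp fun M : Matrix (Fin 4) (Fin 4) k => M.charpoly
    simp only [Function.comp_def, Matrix.charpoly_map] at h1
    exact h1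
  -- `σ`, `σ'` are locally constant (`k` is discrete)
  have hσl : IsLocallyConstant (σ : absoluteGaloisGroup ℚ → GL (Fin 2) k) :=
    (IsLocallyConstant.iff_continuous _).2 (map_continuous σ)
  have hσ'l : IsLocallyConstant (σ' : absoluteGaloisGroup ℚ → GL (Fin 2) k) :=
    (IsLocallyConstant.iff_continuous _).2 (map_continuous σ')
  have hrhs : IsLocallyConstant fun g : absoluteGaloisGroup ℚ =>
      (σ g).val.charpoly * (σ' g).val.charpoly :=
    (hσl.comp fun u : GL (Fin 2) k => u.val.charpoly).mul
      (hσ'l.comp fun u : GL (Fin 2) k => u.val.charpoly)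
  -- so it suffices to check the identity at the Frobenii outside `S`
  refine forall_eq_of_dense hD hlhs hrhs fun x hx => ?_
  obtain ⟨v, hv, 𝔓, h𝔓, hx⟩ := hx
  obtain ⟨hr, hσ, hσ', P₀, P₁, P₂, hP₀, hP₁, hP₂, hred⟩ := hSc v hv
  have h1 : P₁ = (σ x).val.charpoly := hP₁.unique (hσ.hasFrobCharpolyAt_charpoly h𝔓 hx)
  have h2 : P₂ = (σ' x).val.charpoly := hP₂.unique (hσ'.hasFrobCharpolyAt_charpoly h𝔓 hx)
  have h0 : P₀ = (rint x).val.charpoly := by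
    refine hP₀.unique_map ?_
    rw [charpoly_map_subtype_of_map_eq (hrint x)]
    exact hr.hasFrobCharpolyAt_charpoly h𝔓 hx
  subst h0 h1 h2
  exact hred

end Summit.Langlands.Langlands.Cruxes.ResiduallyYoshidaLifting.EndoscopicCrossingEuler
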